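import Mathlib.Data.Nat.Bitwise
import Literature.Computability.Complexity.CRRFacts
import HarnessLib

/-!
# Reading one bit of a number off its Chinese remainder representation: the parity formulas

Arithmetic (circuit-free, machine-free) core of the conversion from Chinese remainder
representation to binary inside the counting hierarchy (Hesse–Allender–Barrington, JCSS 65 (2002),
§4, Lemmas 4.2–4.5 and Thm. 4.1; used scaled-up by Bürgisser, ECCC TR06-113, Thm. 3.4), in the
streamlined form in which the `CH` toolkit applies it. Everything here is proved.

* **Halving by odd blocks** (`div_prod_eq_div_two_pow`, `mod_prod_mod_two_eq`; HAB Thm. 4.1: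
  "dividing `X` by `2ˢ` is quite similar to multiplying `X` by `(∏ (1 + Aᵢ)/2)/(∏ Aᵢ)`"): for odd
  numbers `A₀, …, A_{N-1}` that are large (`Aᵢ > 2N(2X+1)`), with `B = ∏ Aᵢ` and
  `Y = (2X+1) · 2^{N-1-s} · ∏ (Aᵢ+1)/2`, one has `⌊Y/B⌋ = ⌊X/2ˢ⌋` EXACTLY (the shift by `1/2`
  built into `2X+1` removes HAB's final comparison), hence for `s ≤ N - 2` (so that `Y` is even)
  bit `s` of `X` is the parity of `Y mod B`.
* **Parity of a CRR number from one high bit of a short sum of fractions**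
  (`testBit_fracSum_eq`; HAB Lemma 4.3 "`X/M = ∑ xᵢhᵢ/mᵢ - rank`" and Lemma 4.4 "extend the basis
  to `M' = Mp`" with `p = 2` and candidate residue `0`): for a set `P` of `K` odd primes with
  product `B`, residues `Y mod q`, CRT digits `u_q = (Y mod q) · ((2B/q) mod q)⁻¹ mod q` and any
  `R` with `2B(K+2) ≤ 2ᴿ`,
  `bit_{R-1} (K + 1 + ∑_{q ∈ P} ⌊u_q 2ᴿ / q⌋) = [Y mod B is odd]`.
  (The sum is `2ᴿ(rank + Z₀/2B) - ε` with `0 ≤ ε < K`, `Z₀ ∈ {Y mod B, Y mod B + B}` even.)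
* The bits of the fractions `⌊u 2ᴿ/q⌋` (`testBit_mul_two_pow_div`; HAB Lemma 4.2: "the `s`-th bit
  of `1/p` is the low-order bit of `2ˢ mod p`"): bit `e < R` is the parity of `u · 2^{R-e} mod q`.

## References

* W. Hesse, E. Allender, D. A. M. Barrington, *Uniform constant-depth threshold circuits for
  division and iterated multiplication*, JCSS 65 (2002) 695–716, §4 (Lemmas 4.2–4.5, Thm. 4.1).
* P. Bürgisser, ECCC TR06-113 (2006), Thm. 3.4 (scaling HAB Thm. 4.1 up to `CH`).
-/

namespace Literature.Computability.Complexity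

open Finset Nat

namespace CRRParity

/-! ### Bits of `⌊u · 2ᴿ / q⌋` (HAB Lemma 4.2) -/

/-- `⌊⌊x⌋ / 2ᵉ⌋` for `x = u 2ᴿ / q`: `⌊u 2ᴿ/q⌋ / 2ᵉ = ⌊u 2^{R-e}/q⌋` for `e ≤ R`. [folklore] -/
theorem mul_two_pow_div_div (u q R e : ℕ) (he : e ≤ R) : u * 2 ^ R / q / 2 ^ e = u * 2 ^ (R - e) / q := by
  rw [Nat.div_div_eq_div_mul, mul_comm q, ← Nat.div_div_eq_div_mul]
  congr 1
  obtain ⟨d, rfl⟩ := Nat.exists_eq_add_of_le he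
  rw [Nat.add_sub_cancel_left, pow_add, mul_comm (2 ^ e), ← mul_assoc, Nat.mul_div_cancel _ (Nat.two_pow_pos _)]

/-- For odd `q`, the parity of `⌊a/q⌋` for even `a` is the parity of `a mod q`. [folklore] -/
theorem div_mod_two_of_even {a q : ℕ} (hq : q % 2 = 1) (ha : a % 2 = 0) : a / q % 2 = a % q % 2 := by
  have h := Nat.div_add_mod a q
  have h2 : q * (a / q) % 2 = a / q % 2 := by rw [Nat.mul_mod, hq, one_mul, Nat.mod_mod]
  omega

/-- **Bits of a fraction** (HAB 2002, Lemma 4.2, for numerator `u < q`): for odd `q` and `u < q`,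
bit `e` of `⌊u 2ᴿ / q⌋` is `1` iff `e < R` and `u · 2^{R-e} mod q` is odd. [cite: HesseAllenderBarrington2002, Lemma 4.2] -/
theorem testBit_mul_two_pow_div {u q : ℕ} (hq : q % 2 = 1) (hu : u < q) (R e : ℕ) :
    (u * 2 ^ R / q).testBit e = (decide (e < R) && decide (u * 2 ^ (R - e) % q % 2 = 1)) := by
  rw [Nat.testBit_eq_decide_div_mod_eq]
  by_cases he : e < R
  · rw [mul_two_pow_div_div u q R e he.le, decide_eq_true he, Bool.true_and,
      div_mod_two_of_even hq]
    obtain ⟨d, hd⟩ := Nat.exists_eq_add_of_lt he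
    rw [hd, show e + d + 1 - e = d + 1 by omega, pow_succ, ← mul_assoc, Nat.mul_mod_left]
  · rw [decide_eq_false he, Bool.false_and, decide_eq_false]
    have hlt : u * 2 ^ R / q < 2 ^ e := by
      rcases Nat.eq_zero_or_pos q with rfl | hq0
      · simp at hq
      · calc u * 2 ^ R / q ≤ u * 2 ^ R / (u + 1) := Nat.div_le_div_left (by omega) (by omega)
          _ < 2 ^ R := by
            rw [Nat.div_lt_iff_lt_mul (by omega)]
            have := Nat.two_pow_pos R
            nlinarith
          _ ≤ 2 ^ e := Nat.pow_le_pow_right (by norm_num) (by omega)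
    rw [Nat.div_eq_of_lt hlt]
    omega

/-! ### Halving by odd blocks (HAB Thm. 4.1) -/

section Halving

variable (A : ℕ → ℕ) (N : ℕ)

/-- `∏ (Aᵢ + 1) ≤ (1 + 2N/m) ∏ Aᵢ` in integers: `m ∏_{i<N} (Aᵢ+1) ≤ (m + 2N) ∏_{i<N} Aᵢ` when
`m ≤ Aᵢ` and `2N ≤ m` (HAB 2002, proof of Thm. 4.1: "`∏ (Aᵢ+1)/∏ Aᵢ < (1 + 1/M)ˢ < 1 + (s+1)/M`"). [cite: HesseAllenderBarrington2002, Theorem 4.1] -/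
theorem mul_prod_succ_le {m : ℕ} (hm : ∀ i < N, m ≤ A i) (hN : 2 * N ≤ m) :
    m * ∏ i ∈ range N, (A i + 1) ≤ (m + 2 * N) * ∏ i ∈ range N, A i := by
  induction N with
  | zero => simp
  | succ n ih =>
    have ih' := ih (fun i hi => hm i (Nat.lt_succ_of_lt hi)) (by omega)
    have hAn : m ≤ A n := hm n (Nat.lt_succ_self n)
    rw [prod_range_succ, prod_range_succ, ← mul_assoc, mul_comm (m + 2 * (n + 1))]
    calc m * (∏ i ∈ range n, (A i + 1)) * (A n + 1)
        ≤ (m + 2 * n) * (∏ i ∈ range n, A i) * (A n + 1) := Nat.mul_le_mul_right _ ih'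
      _ = ((m + 2 * n) * (A n + 1)) * ∏ i ∈ range n, A i := by ring
      _ ≤ ((m + 2 * (n + 1)) * A n) * ∏ i ∈ range n, A i := Nat.mul_le_mul_right _ (by nlinarith)
      _ = (∏ i ∈ range n, A i) * A n * (m + 2 * (n + 1)) := by ring

/-- `2ᴺ ∏_{i<N} (Aᵢ+1)/2 = ∏_{i<N} (Aᵢ+1)` for odd `Aᵢ`. [folklore] -/
theorem two_pow_mul_prod_half (hodd : ∀ i < N, A i % 2 = 1) :
    2 ^ N * ∏ i ∈ range N, (A i + 1) / 2 = ∏ i ∈ range N, (A i + 1) := by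
  induction N with
  | zero => simp
  | succ n ih =>
    rw [prod_range_succ, prod_range_succ, pow_succ, ← ih (fun i hi => hodd i (Nat.lt_succ_of_lt hi))]
    have h := hodd n (Nat.lt_succ_self n)
    have h2 : 2 * ((A n + 1) / 2) = A n + 1 := by omega
    calc 2 ^ n * 2 * ((∏ i ∈ range n, (A i + 1) / 2) * ((A n + 1) / 2))
        = 2 ^ n * (∏ i ∈ range n, (A i + 1) / 2) * (2 * ((A n + 1) / 2)) := by ring
      _ = 2 ^ n * (∏ i ∈ range n, (A i + 1) / 2) * (A n + 1) := by rw [h2]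

/-- A product of odd numbers is odd. [folklore] -/
theorem prod_mod_two_eq_one (hodd : ∀ i < N, A i % 2 = 1) : (∏ i ∈ range N, A i) % 2 = 1 := by
  induction N with
  | zero => simp
  | succ n ih =>
    rw [prod_range_succ, Nat.mul_mod, ih (fun i hi => hodd i (Nat.lt_succ_of_lt hi)), hodd n (Nat.lt_succ_self n)]

/-- **Exact halving by odd blocks** (HAB 2002, Thm. 4.1, with the built-in shift `X ↦ 2X+1` that
makes the quotient exact): for odd `Aᵢ > 2N(2X+1)` (`i < N`, `2N ≤ Aᵢ`), `B = ∏ Aᵢ` and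
`Y = (2X+1) 2^{N-1-s} ∏ (Aᵢ+1)/2` with `s ≤ N - 1`, one has `⌊Y/B⌋ = ⌊X/2ˢ⌋`. [cite: HesseAllenderBarrington2002, Theorem 4.1] -/
theorem div_prod_eq_div_two_pow (X s : ℕ) (hs : s + 1 ≤ N) (hodd : ∀ i < N, A i % 2 = 1)
    (hbig : ∀ i < N, 2 * N * (2 * X + 1) < A i) :
    (2 * X + 1) * 2 ^ (N - 1 - s) * (∏ i ∈ range N, (A i + 1) / 2) / (∏ i ∈ range N, A i) = X / 2 ^ s := by
  set B := ∏ i ∈ range N, A i with hB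
  set Q := X / 2 ^ s with hQ
  set Y := (2 * X + 1) * 2 ^ (N - 1 - s) * ∏ i ∈ range N, (A i + 1) / 2 with hY
  -- the key identity `Y · 2^{s+1} = (2X+1) ∏ (Aᵢ+1)`
  have hY2 : Y * 2 ^ (s + 1) = (2 * X + 1) * ∏ i ∈ range N, (A i + 1) := by
    rw [← two_pow_mul_prod_half A N hodd, hY, show N = (N - 1 - s) + (s + 1) by omega, pow_add]
    simp only [show N - 1 - s + (s + 1) - 1 - s = N - 1 - s by omega]
    ring
  have hBpos : 0 < B := by
    rw [hB]; exact prod_pos fun i hi => by have := hodd i (mem_range.1 hi); omega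
  have hXQ : 2 ^ s * Q ≤ X := Nat.mul_div_le X (2 ^ s)
  have hXQ' : X < 2 ^ s * (Q + 1) := by
    have := Nat.lt_div_mul_add (a := X) (Nat.two_pow_pos s)
    rw [hQ]; linarith
  have hBle : B ≤ ∏ i ∈ range N, (A i + 1) := prod_le_prod' fun i _ => Nat.le_succ _
  refine Nat.div_eq_of_lt_le ?_ ?_
  · -- `Q B ≤ Y` from `Q B 2^{s+1} ≤ 2X B < (2X+1) ∏(A+1) = Y 2^{s+1}`
    refine Nat.le_of_mul_le_mul_right ?_ (Nat.two_pow_pos (s + 1))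
    rw [hY2]
    calc Q * B * 2 ^ (s + 1) = (2 * (2 ^ s * Q)) * B := by rw [pow_succ]; ring
      _ ≤ (2 * X + 1) * B := Nat.mul_le_mul_right _ (by omega)
      _ ≤ (2 * X + 1) * ∏ i ∈ range N, (A i + 1) := Nat.mul_le_mul_left _ hBle
  · -- `Y < (Q+1) B`: multiply by `2^{s+1} m` with `m = min Aᵢ`
    rcases Nat.eq_zero_or_pos N with hN0 | hNpos
    · omega
    -- a uniform lower bound `m` for the `Aᵢ`
    obtain ⟨i₀, hi₀, hmin⟩ := exists_min_image (range N) A ⟨0, mem_range.2 hNpos⟩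
    set m := A i₀ with hm
    have hmA : ∀ i < N, m ≤ A i := fun i hi => hmin i (mem_range.2 hi)
    have hmbig : 2 * N * (2 * X + 1) < m := hbig i₀ (mem_range.1 hi₀)
    have h2N : 2 * N ≤ m := le_trans (Nat.le_mul_of_pos_right _ (by omega)) hmbig.le
    have hmpos : 0 < m := by omega
    have key := mul_prod_succ_le A N hmA h2N
    -- `Y 2^{s+1} m = (2X+1) m ∏(A+1) ≤ (2X+1)(m+2N) B < (2X+2) m B ≤ 2^{s+1}(Q+1) m B`
    refine Nat.lt_of_mul_lt_mul_right (a := 2 ^ (s + 1) * m) ?_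
    calc Y * (2 ^ (s + 1) * m) = m * ((2 * X + 1) * ∏ i ∈ range N, (A i + 1)) := by rw [← hY2]; ring
      _ = (2 * X + 1) * (m * ∏ i ∈ range N, (A i + 1)) := by ring
      _ ≤ (2 * X + 1) * ((m + 2 * N) * B) := Nat.mul_le_mul_left _ key
      _ = ((2 * X + 1) * m + (2 * X + 1) * (2 * N)) * B := by ring
      _ < ((2 * X + 1) * m + m) * B := by
          refine Nat.mul_lt_mul_of_lt_of_le (Nat.add_lt_add_left (by nlinarith) _) le_rfl hBpos
      _ = (2 * X + 2) * m * B := by ring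
      _ ≤ (2 ^ (s + 1) * (Q + 1)) * m * B := by
          refine Nat.mul_le_mul_right _ (Nat.mul_le_mul_right _ ?_)
          rw [pow_succ]; nlinarith
      _ = (Q + 1) * B * (2 ^ (s + 1) * m) := by ring

/-- **Bit `s` of `X` is the parity of `Y mod B`** (for `s ≤ N - 2`, so that `Y` is even; `B` is odd):
`Y = B ⌊X/2ˢ⌋ + (Y mod B)` modulo `2`. [cite: HesseAllenderBarrington2002, Theorem 4.1] -/
theorem mod_prod_mod_two_eq (X s : ℕ) (hs : s + 2 ≤ N) (hodd : ∀ i < N, A i % 2 = 1)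
    (hbig : ∀ i < N, 2 * N * (2 * X + 1) < A i) :
    (2 * X + 1) * 2 ^ (N - 1 - s) * (∏ i ∈ range N, (A i + 1) / 2) % (∏ i ∈ range N, A i) % 2 = X / 2 ^ s % 2 := by
  set B := ∏ i ∈ range N, A i with hB
  set Y := (2 * X + 1) * 2 ^ (N - 1 - s) * ∏ i ∈ range N, (A i + 1) / 2 with hY
  have hdiv : Y / B = X / 2 ^ s := div_prod_eq_div_two_pow A N X s (by omega) hodd hbig
  have hdm := Nat.div_add_mod Y B
  rw [hdiv] at hdm
  have hYeven : Y % 2 = 0 := by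
    rw [hY, show N - 1 - s = (N - 2 - s) + 1 by omega, pow_succ]
    simp [Nat.mul_mod]
  have hBodd : B % 2 = 1 := prod_mod_two_eq_one A N hodd
  have hBQ : B * (X / 2 ^ s) % 2 = X / 2 ^ s % 2 := by rw [Nat.mul_mod, hBodd, one_mul, Nat.mod_mod]
  omega

end Halving

/-- The high bit of a number below `2ᴿ`: bit `R - 1` of `W < 2ᴿ` is `[2^{R-1} ≤ W]`. [folklore] -/
theorem testBit_pred_eq_decide {W R : ℕ} (hR : 1 ≤ R) (hW : W < 2 ^ R) : W.testBit (R - 1) = decide (2 ^ (R - 1) ≤ W) := by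
  obtain ⟨r, rfl⟩ := Nat.exists_eq_add_of_le' hR
  rw [Nat.add_sub_cancel]
  rw [_root_.pow_succ'] at hW
  rw [Nat.testBit_eq_decide_div_mod_eq]
  have h2 : W / 2 ^ r < 2 := by rwa [Nat.div_lt_iff_lt_mul (Nat.two_pow_pos _)]
  by_cases hle : 2 ^ r ≤ W
  · have h1 : 1 ≤ W / 2 ^ r := (Nat.le_div_iff_mul_le (Nat.two_pow_pos _)).2 (by simpa using hle)
    rw [decide_eq_true hle, decide_eq_true (by omega)]
  · rw [decide_eq_false hle, Nat.div_eq_of_lt (not_le.1 hle)]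
    decide

/-! ### One high bit of the fraction sum gives the parity (HAB Lemmas 4.3–4.4 with `p = 2`) -/

section FracSum

variable (P : Finset ℕ) (hP : ∀ q ∈ P, q.Prime ∧ q % 2 = 1)
include hP

/-- A product of odd primes is odd. [folklore] -/
theorem prod_primes_mod_two : (∏ q ∈ P, q) % 2 = 1 := by
  rw [prod_nat_mod, prod_congr rfl fun q hq => (hP q hq).2, prod_const_one]
  decide

/-- The cofactor `2 ∏_{q' ≠ q} q'` of a base prime `q` is not divisible by `q`. [folklore] -/
theorem cofactor_mod_ne_zero {q : ℕ} (hq : q ∈ P) : (2 * ∏ q' ∈ P.erase q, q') % q ≠ 0 := by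
  intro h
  have hqp := (hP q hq).1
  have hdvd : q ∣ 2 * ∏ q' ∈ P.erase q, q' := Nat.dvd_of_mod_eq_zero h
  rcases (Nat.Prime.dvd_mul hqp).1 hdvd with h2 | hprod
  · have := Nat.le_of_dvd two_pos h2
    have := hqp.two_le
    have := (hP q hq).2
    omega
  · obtain ⟨q', hq', hqq'⟩ := (Prime.dvd_finsetProd_iff hqp.prime _).1 hprod
    have hq'P := mem_of_mem_erase hq'
    have heq : q = q' := (Nat.prime_dvd_prime_iff_eq hqp (hP q' hq'P).1).1 hqq'
    exact (ne_of_mem_erase hq') heq.symm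

/-- **The CRT digit inverts the cofactor** (Fermat): `c · c^{q-2} ≡ 1 (mod q)` for the cofactor
residue `c = (2 ∏_{q' ≠ q} q') mod q`. [folklore] -/
theorem cofactor_mul_inv_mod {q : ℕ} (hq : q ∈ P) :
    (2 * ∏ q' ∈ P.erase q, q') % q * ((2 * ∏ q' ∈ P.erase q, q') % q) ^ (q - 2) % q = 1 := by
  have hqp := (hP q hq).1
  set c := (2 * ∏ q' ∈ P.erase q, q') % q with hc
  have hc0 : 0 < c := Nat.pos_of_ne_zero (cofactor_mod_ne_zero P hP hq)
  have hcq : c < q := Nat.mod_lt _ hqp.pos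
  have h1 : c * c ^ (q - 2) = c ^ (q - 1) := by
    rw [← pow_succ']; congr 1; have := hqp.two_le; omega
  rw [h1]
  exact pow_sub_one_mod_prime hqp hc0 hcq

/-- **The CRT combination has the prescribed residues**: with `C_q = 2 ∏_{q'≠q} q'`,
`h_q = (C_q mod q)^{q-2} mod q` and `u_q = (Y mod q) h_q mod q`, the number `N = ∑_q u_q C_q`
satisfies `N ≡ Y (mod q)` for every base prime `q` (HAB 2002, §4: "`X` is congruent modulo `M` to
`∑ xᵢhᵢCᵢ`"). [cite: HesseAllenderBarrington2002, §4] -/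
theorem crtSum_mod_eq (Y : ℕ) {q : ℕ} (hq : q ∈ P) :
    (∑ q' ∈ P, (Y % q' * (((2 * ∏ q'' ∈ P.erase q', q'') % q') ^ (q' - 2) % q') % q') *
        (2 * ∏ q'' ∈ P.erase q', q'')) % q = Y % q := by
  have hqp := (hP q hq).1
  rw [← add_sum_erase P _ hq, Nat.add_mod, sum_nat_mod]
  have hrest : ∀ q' ∈ P.erase q, (Y % q' * (((2 * ∏ q'' ∈ P.erase q', q'') % q') ^ (q' - 2) % q') % q') *
      (2 * ∏ q'' ∈ P.erase q', q'') % q = 0 := by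
    intro q' hq'
    apply Nat.mod_eq_zero_of_dvd
    apply Dvd.dvd.mul_left
    apply Dvd.dvd.mul_left
    exact dvd_prod_of_mem _ (mem_erase.2 ⟨(ne_of_mem_erase hq').symm, hq⟩)
  rw [sum_congr rfl hrest, sum_const_zero, Nat.zero_mod, add_zero, Nat.mod_mod]
  -- the main term: `(Y mod q) h c ≡ Y (mod q)`
  have hinv := cofactor_mul_inv_mod P hP hq
  set c := 2 * ∏ q'' ∈ P.erase q, q'' with hc
  have e3 : (c % q) ^ (q - 2) % q * c ≡ 1 [MOD q] := by
    calc (c % q) ^ (q - 2) % q * c ≡ (c % q) ^ (q - 2) * (c % q) [MOD q] :=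
          (Nat.mod_modEq _ _).mul (Nat.mod_modEq _ _).symm
      _ = c % q * (c % q) ^ (q - 2) := mul_comm _ _
      _ ≡ 1 [MOD q] := by
          change c % q * (c % q) ^ (q - 2) % q = 1 % q
          rw [Nat.one_mod_eq_one.2 hqp.one_lt.ne', hinv]
  have hmod : Y % q * ((c % q) ^ (q - 2) % q) % q * c ≡ Y [MOD q] :=
    calc Y % q * ((c % q) ^ (q - 2) % q) % q * c ≡ Y * ((c % q) ^ (q - 2) % q) * c [MOD q] :=
          ((Nat.mod_modEq _ _).trans ((Nat.mod_modEq _ _).mul_right _)).mul_right _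
      _ = Y * ((c % q) ^ (q - 2) % q * c) := by ring
      _ ≡ Y * 1 [MOD q] := (Nat.ModEq.refl _).mul e3
      _ = Y := mul_one _
  exact hmod

/-- **Parity of a CRR number from one bit of the fraction sum** (HAB 2002, Lemma 4.3 "we can compute
`X/M` to polynomially many bits of accuracy … `X/M = ∑ xᵢhᵢ(1/mᵢ) - rank`" and Lemma 4.4 "extend the
basis to `M' = Mp`", here with `p = 2` and the candidate residue `0`): for a set `P` of `K` odd
primes with product `B`, a number `Y`, CRT digits `u_q = (Y mod q)·((2B/q) mod q)⁻¹ mod q` and `R`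
with `2B(K+2) ≤ 2ᴿ`, bit `R - 1` of `K + 1 + ∑_{q∈P} ⌊u_q 2ᴿ/q⌋` is `1` iff `Y mod B` is odd. [cite: HesseAllenderBarrington2002, Lemma 4.3] -/
theorem testBit_fracSum_eq (Y R : ℕ) (hR : 2 * (∏ q ∈ P, q) * (P.card + 2) ≤ 2 ^ R) :
    ((∑ q ∈ P, Y % q * (((2 * ∏ q' ∈ P.erase q, q') % q) ^ (q - 2) % q) % q * 2 ^ R / q) + P.card + 1).testBit (R - 1) =
      decide (Y % (∏ q ∈ P, q) % 2 = 1) := by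
  have hBpos : 0 < ∏ q ∈ P, q := prod_pos fun q hq => (hP q hq).1.pos
  have hBodd : (∏ q ∈ P, q) % 2 = 1 := prod_primes_mod_two P hP
  have hR2 : 4 ≤ 2 ^ R := le_trans (by nlinarith [hBpos]) hR
  have hR1 : 2 ≤ R := by
    rcases Nat.lt_or_ge R 2 with h | h
    · interval_cases R <;> norm_num at hR2
    · exact h
  -- the empty base
  rcases P.eq_empty_or_nonempty with hPe | hPne
  · subst hPe
    rw [sum_empty, card_empty, prod_empty, Nat.mod_one, zero_add, zero_add,
      Nat.testBit_lt_two_pow (Nat.one_lt_two_pow (by omega))]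
    decide
  -- notation: `B`, `K`, `T = 2ᴿ`, cofactors `C q`, digits `u q`, the CRT sum `N`, the modulus `M = 2B`
  set B := ∏ q ∈ P, q with hB
  set K := P.card with hK
  set T := 2 ^ R with hT
  set C : ℕ → ℕ := fun q => 2 * ∏ q' ∈ P.erase q, q' with hC
  set u : ℕ → ℕ := fun q => Y % q * ((C q % q) ^ (q - 2) % q) % q with hu
  set N := ∑ q ∈ P, u q * C q with hN
  set M := 2 * B with hM
  have hqC : ∀ q ∈ P, q * C q = M := fun q hq => by
    have hpe : q * ∏ q' ∈ P.erase q, q' = B := by rw [hB]; exact mul_prod_erase P (fun x => x) hq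
    rw [hC, hM]; dsimp only; rw [mul_left_comm, hpe]
  have hMpos : 0 < M := by omega
  have hCpos : ∀ q ∈ P, 0 < C q := fun q hq => by
    rcases Nat.eq_zero_or_pos (C q) with h0 | h0
    · have := hqC q hq; rw [h0, mul_zero] at this; omega
    · exact h0
  -- (a) residues of `N`, hence `N ≡ Y (mod B)`
  have hNq : ∀ q ∈ P, N % q = Y % q := fun q hq => crtSum_mod_eq P hP Y hq
  have hNB : N % B = Y % B := mod_prod_eq_of_forall_mod_eq (fun q hq => (hP q hq).1) hNq
  -- (b) `N` is even
  have hNeven : N % 2 = 0 := by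
    rw [hN, sum_nat_mod, sum_congr rfl fun q _ => ?_, sum_const_zero, Nat.zero_mod]
    rw [hC]; dsimp only
    rw [Nat.mul_mod, Nat.mul_mod 2, Nat.mod_self, zero_mul, Nat.zero_mod, mul_zero, Nat.zero_mod]
  -- (c) the floor sum `S` and its two-sided estimate `M S ≤ T N < M (S + K)`
  set S := ∑ q ∈ P, u q * 2 ^ R / q with hS
  have hSq : ∀ q ∈ P, u q * 2 ^ R / q = u q * C q * 2 ^ R / M := fun q hq => by
    rw [← hqC q hq, mul_right_comm, Nat.mul_div_mul_right _ _ (hCpos q hq)]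
  have hS' : S = ∑ q ∈ P, u q * C q * 2 ^ R / M := sum_congr rfl hSq
  have hsumx : ∑ q ∈ P, u q * C q * 2 ^ R = T * N := by
    rw [hN, mul_sum]; exact sum_congr rfl fun q _ => by rw [hT]; ring
  have h1 : M * S ≤ T * N :=
    calc M * S = ∑ q ∈ P, M * (u q * C q * 2 ^ R / M) := by rw [hS', mul_sum]
      _ ≤ ∑ q ∈ P, u q * C q * 2 ^ R := sum_le_sum fun q _ => Nat.mul_div_le _ _
      _ = T * N := hsumx
  have h2 : T * N < M * S + M * K := by
    have hlt : ∀ q ∈ P, u q * C q * 2 ^ R < M * (u q * C q * 2 ^ R / M) + M := fun q _ => by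
      have := Nat.lt_mul_div_succ (u q * C q * 2 ^ R) hMpos; linarith
    calc T * N = ∑ q ∈ P, u q * C q * 2 ^ R := hsumx.symm
      _ < ∑ q ∈ P, (M * (u q * C q * 2 ^ R / M) + M) := sum_lt_sum_of_nonempty hPne hlt
      _ = M * S + M * K := by rw [sum_add_distrib, ← mul_sum, ← hS', sum_const, smul_eq_mul, hK]; ring
  -- (d) `N = M rank + Z₀`
  set Z0 := N % M with hZ0
  set rank := N / M with hrank
  have hNMZ : N = M * rank + Z0 := (Nat.div_add_mod N M).symm
  have hZ0M : Z0 < M := Nat.mod_lt _ hMpos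
  have hZ0even : Z0 % 2 = 0 := by rw [hZ0, hM, Nat.mod_mod_of_dvd _ (dvd_mul_right 2 B)]; exact hNeven
  have hZ0B : Z0 % B = Y % B := by rw [hZ0, hM, Nat.mod_mod_of_dvd _ (dvd_mul_left B 2), hNB]
  have e2 : T * N = M * (T * rank) + T * Z0 := by rw [hNMZ]; ring
  -- (e) `S + K + 1 = T rank + W` with `W < T`
  have hle : T * rank ≤ S + K := by
    have h3 : M * (T * rank) < M * (S + K) :=
      calc M * (T * rank) ≤ T * N := by rw [e2]; exact Nat.le_add_right _ _
        _ < M * S + M * K := h2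
        _ = M * (S + K) := by ring
    exact (Nat.lt_of_mul_lt_mul_left h3).le
  obtain ⟨W, hW⟩ := Nat.exists_eq_add_of_le (Nat.le_succ_of_le hle)
  have hW' : S + K + 1 = T * rank + W := hW
  have e1 : M * W + M * (T * rank) = M * S + M * K + M := by
    calc M * W + M * (T * rank) = M * (T * rank + W) := by ring
      _ = M * (S + K + 1) := by rw [← hW']
      _ = M * S + M * K + M := by ring
  have hMW : M * W ≤ T * Z0 + M * K + M := by linarith
  have hMK : M * K + M + M ≤ T := by
    have : M * (K + 2) = M * K + M + M := by ring
    rw [← this, hM, hT]; exact hR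
  have hZT : T * Z0 + T ≤ M * T := by
    have := Nat.mul_le_mul_left T (Nat.succ_le_of_lt hZ0M)
    rw [Nat.mul_succ] at this; linarith [mul_comm T M]
  have hWlt : W < T := Nat.lt_of_mul_lt_mul_left (a := M) (by linarith)
  -- (f) bit `R-1` of `S + K + 1` is bit `R-1` of `W`, i.e. `[2^{R-1} ≤ W]`
  set T' := 2 ^ (R - 1) with hT'
  have hTT' : T = 2 * T' := by
    rw [hT, hT']
    obtain ⟨r, hr⟩ := Nat.exists_eq_add_of_le' (show 1 ≤ R by omega)
    rw [hr, Nat.add_sub_cancel, _root_.pow_succ']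
  have hbit : (S + K + 1).testBit (R - 1) = decide (T' ≤ W) := by
    rw [hW', hT, Nat.testBit_two_pow_mul_add rank (hT ▸ hWlt), if_pos (by omega),
      testBit_pred_eq_decide (by omega) (hT ▸ hWlt)]
  rw [hbit]
  have hMT' : M * T' = T * B := by rw [hM, hTT']; ring
  -- (g) the two cases `Z₀ < B` (parity even) and `B ≤ Z₀` (parity odd)
  by_cases hZB : Z0 < B
  · -- `W < T'` and `Y mod B = Z₀` is even
    have hYB : Y % B = Z0 := by rw [← hZ0B, Nat.mod_eq_of_lt hZB]
    have hWsmall : ¬ T' ≤ W := by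
      intro hle'
      have hZ : T * Z0 + T ≤ T * B := by
        have := Nat.mul_le_mul_left T (Nat.succ_le_of_lt hZB)
        rwa [Nat.mul_succ] at this
      have : M * T' ≤ M * W := Nat.mul_le_mul_left _ hle'
      linarith
    rw [decide_eq_false hWsmall, hYB, decide_eq_false (by omega)]
  · -- `T' ≤ W` and `Y mod B = Z₀ - B` is odd
    push Not at hZB
    have hYB : Y % B = Z0 - B := by
      rw [← hZ0B, Nat.mod_eq_sub_mod hZB, Nat.mod_eq_of_lt (by omega)]
    have hWbig : T' ≤ W := by
      by_contra hlt
      push Not at hlt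
      have : M * W < M * T' := (Nat.mul_lt_mul_left hMpos).2 hlt
      have : T * B ≤ T * Z0 := Nat.mul_le_mul_left _ hZB
      linarith
    rw [decide_eq_true hWbig, hYB, decide_eq_true (by omega)]

end FracSum

end CRRParity

end Literature.Computability.Complexity
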